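import Mathlib
import Summits.Ventures.PercRepro2.PairExchangeable

/-!
# Two-copy typed bases in measure language: product couplings of two copies
(blind cell PercRepro2, typer-1 g15, 2026-08-26)

The two-copy companion of `TriExchangeableMeasure.lean`: a coupling of two copies of the bond
process that is a product over the edges is `Measure.pi ν` for edge measures `ν e` on the two
states `Bool × Bool` of an edge, exchangeable when `(ν e).map Prod.swap = ν e`.

* `law₂ m a b = m.real {(a, b)}` is the edge law of a measure; `integral_pi_eq_pairExpect`:
  `∫ ξ, Φ (ξ₁) (ξ₂) ∂(Measure.pi ν) = pairExpect (fun e => law₂ (ν e)) Φ` for finite `ν e`;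
* `lawMeasure₂ l` is the measure with edge law `l`; the typed laws `nu₂ k`, `k ≤ 2`, give
  probability measures (`lawMeasure₂_nu₂_isProbabilityMeasure`);
* **`typedSum_nonneg_iff_probabilityMeasure`** : `(∀ n, 0 ≤ typedSum Φ n) ↔ ∀ ν probability,
  swap-invariant, 0 ≤ ∫ ξ, Φ (ξ₁) (ξ₂) ∂(Measure.pi ν)` (and `typedSum_nonneg_iff_measure` with
  finite measures) — the two-copy typed bases of `Φ` (rows 2′TBHK, 2′W) are nonnegative iff
  `E[Φ(X, Y)] ≥ 0` for every pair of copies `(X, Y)` whose joint law is a product over the edges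
  of exchangeable laws.

Own work; standard axioms.
-/

namespace Summit.Ventures.PercRepro2

namespace PairExchange

open MeasureTheory
open scoped ENNReal

/-! ## The two copies of an edge state -/

section States

/-- The preimage of a point under `Prod.swap` (an involution). -/
lemma preimage_swap_singleton (t : Bool × Bool) : Prod.swap ⁻¹' {t} = {t.swap} := by
  obtain ⟨a, b⟩ := t
  ext ⟨x, y⟩
  simp only [Set.mem_preimage, Set.mem_singleton_iff, Prod.swap_prod_mk, Prod.mk.injEq]
  tauto

/-- The edge law of a measure on the two states of an edge: the masses of the points. -/
noncomputable def law₂ (m : Measure (Bool × Bool)) (a b : Bool) : ℝ := m.real {(a, b)}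

/-- Edge laws of measures are nonnegative. -/
lemma law₂_nonneg (m : Measure (Bool × Bool)) (a b : Bool) : 0 ≤ law₂ m a b :=
  measureReal_nonneg

/-- The point masses of a swap-invariant measure. -/
lemma apply_singleton_swap {m : Measure (Bool × Bool)} (h : m.map Prod.swap = m) (t : Bool × Bool) :
    m {t.swap} = m {t} := by
  conv_rhs => rw [← h]
  rw [Measure.map_apply (measurable_of_countable _) (measurableSet_singleton _),
    preimage_swap_singleton]

/-- **The edge law of a swap-invariant measure is symmetric.** -/
lemma law₂_isSymmetric {m : Measure (Bool × Bool)} (h : m.map Prod.swap = m) :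
    IsSymmetric (law₂ m) := by
  intro a b
  show m.real {(a, b)} = m.real {(b, a)}
  rw [measureReal_def, measureReal_def, ← apply_singleton_swap h (a, b)]
  rfl

end States

/-! ## Product couplings and the expectation of a two-copy function -/

section Coupling

variable {E : Type*} [Fintype E] [DecidableEq E]

/-- The first copy of a two-copy state. -/
def pair₁ (ξ : E → Bool × Bool) : Config E := fun e => (ξ e).1

/-- The second copy of a two-copy state. -/
def pair₂ (ξ : E → Bool × Bool) : Config E := fun e => (ξ e).2

/-- Two-copy states are pairs of configurations. -/
def pairEquiv : (E → Bool × Bool) ≃ Config E × Config E where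
  toFun ξ := (pair₁ ξ, pair₂ ξ)
  invFun t := fun e => (t.1 e, t.2 e)
  left_inv _ := rfl
  right_inv _ := rfl

/-- A sum over two-copy states is a double sum over configurations. -/
lemma sum_pair (g : Config E → Config E → ℝ) :
    ∑ ξ : E → Bool × Bool, g (pair₁ ξ) (pair₂ ξ) = ∑ x, ∑ y, g x y := by
  rw [Fintype.sum_equiv pairEquiv (fun ξ => g (pair₁ ξ) (pair₂ ξ)) (fun t => g t.1 t.2)
    (fun _ => rfl), Fintype.sum_prod_type]

/-- **The expectation of a two-copy function under a product coupling** is the finite-sum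
expectation `pairExpect` under the edge laws of the factors. -/
theorem integral_pi_eq_pairExpect (ν : E → Measure (Bool × Bool)) [∀ e, IsFiniteMeasure (ν e)]
    (Φ : Config E → Config E → ℝ) :
    ∫ ξ, Φ (pair₁ ξ) (pair₂ ξ) ∂(Measure.pi ν) = pairExpect (fun e => law₂ (ν e)) Φ := by
  rw [integral_fintype Integrable.of_finite, pairExpect,
    ← sum_pair (fun x y => (∏ e, law₂ (ν e) (x e) (y e)) * Φ x y)]
  refine Finset.sum_congr rfl fun ξ _ => ?_
  rw [smul_eq_mul, measureReal_def, Measure.pi_singleton, ENNReal.toReal_prod]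
  rfl

end Coupling

/-! ## Measures with a prescribed edge law -/

section LawMeasure

/-- The measure on the two states of an edge with edge law `l` (a combination of Dirac masses;
negative values of `l` are truncated to `0`). -/
noncomputable def lawMeasure₂ (l : Bool → Bool → ℝ) : Measure (Bool × Bool) :=
  ∑ t : Bool × Bool, ENNReal.ofReal (l t.1 t.2) • Measure.dirac t

/-- The point masses of `lawMeasure₂ l`. -/
lemma lawMeasure₂_singleton (l : Bool → Bool → ℝ) (t : Bool × Bool) :
    lawMeasure₂ l {t} = ENNReal.ofReal (l t.1 t.2) := by
  unfold lawMeasure₂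
  rw [Measure.finsetSum_apply]
  simp only [Measure.smul_apply, Measure.dirac_apply, smul_eq_mul, Set.indicator_apply,
    Set.mem_singleton_iff, Pi.one_apply, mul_ite, mul_one, mul_zero, Finset.sum_ite_eq',
    Finset.mem_univ, if_true]

/-- The total mass of `lawMeasure₂ l`. -/
lemma lawMeasure₂_univ (l : Bool → Bool → ℝ) :
    lawMeasure₂ l Set.univ = ∑ t : Bool × Bool, ENNReal.ofReal (l t.1 t.2) := by
  unfold lawMeasure₂
  rw [Measure.finsetSum_apply]
  simp only [Measure.smul_apply, Measure.dirac_apply, smul_eq_mul, Set.indicator_univ,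
    Pi.one_apply, mul_one]

/-- The edge law of `lawMeasure₂ l` is `l` when `l` is nonnegative. -/
lemma law₂_lawMeasure₂ {l : Bool → Bool → ℝ} (hl : ∀ a b, 0 ≤ l a b) : law₂ (lawMeasure₂ l) = l := by
  funext a b
  show (lawMeasure₂ l).real {(a, b)} = l a b
  rw [measureReal_def, lawMeasure₂_singleton, ENNReal.toReal_ofReal (hl a b)]

/-- `lawMeasure₂` of a symmetric law is swap-invariant. -/
lemma map_swap_lawMeasure₂ {l : Bool → Bool → ℝ} (hl : IsSymmetric l) :
    (lawMeasure₂ l).map Prod.swap = lawMeasure₂ l := by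
  refine Measure.ext_of_singleton fun t => ?_
  rw [Measure.map_apply (measurable_of_countable _) (measurableSet_singleton _),
    preimage_swap_singleton, lawMeasure₂_singleton, lawMeasure₂_singleton]
  obtain ⟨a, b⟩ := t
  show ENNReal.ofReal (l b a) = ENNReal.ofReal (l a b)
  rw [hl a b]

/-- The typed law `nu₂ k` has total mass `1` for `k ≤ 2`. -/
lemma sum_nu₂ (k : ℕ) (hk : k ≤ 2) : ∑ t : Bool × Bool, nu₂ (R := ℝ) k t.1 t.2 = 1 := by
  have h0 : Nat.choose 2 0 = 1 := by decide
  have h1 : Nat.choose 2 1 = 2 := by decide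
  have h2 : Nat.choose 2 2 = 1 := by decide
  interval_cases k <;>
    simp only [Fintype.sum_prod_type, Fintype.sum_bool, nu₂, cnt₂, Bool.toNat_true,
      Bool.toNat_false] <;>
    norm_num [h0, h1, h2]

/-- **The typed laws give probability measures** (`k ≤ 2`). -/
lemma lawMeasure₂_nu₂_isProbabilityMeasure (k : ℕ) (hk : k ≤ 2) :
    IsProbabilityMeasure (lawMeasure₂ (nu₂ (R := ℝ) k)) := by
  refine ⟨?_⟩
  rw [lawMeasure₂_univ, ← ENNReal.ofReal_sum_of_nonneg (fun t _ => nu₂_nonneg k _ _), sum_nu₂ k hk,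
    ENNReal.ofReal_one]

end LawMeasure

/-! ## The typed bases -/

section Bases

variable {E : Type*} [Fintype E] [DecidableEq E]

/-- **Two-copy typed bases from exchangeable product probability couplings**: if `E[Φ(X, Y)] ≥ 0`
for every pair of copies whose joint law is a product over the edges of swap-invariant probability
measures, then every typed sum of `Φ` is nonnegative. -/
theorem typedSum_nonneg_of_probabilityMeasure (Φ : Config E → Config E → ℝ)
    (h : ∀ (ν : E → Measure (Bool × Bool)) [∀ e, IsProbabilityMeasure (ν e)],
      (∀ e, (ν e).map Prod.swap = ν e) → 0 ≤ ∫ ξ, Φ (pair₁ ξ) (pair₂ ξ) ∂(Measure.pi ν))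
    (n : E → ℕ) : 0 ≤ typedSum Φ n := by
  by_cases hn : ∀ e, n e ≤ 2
  · haveI : ∀ e, IsProbabilityMeasure (lawMeasure₂ (nu₂ (R := ℝ) (n e))) :=
      fun e => lawMeasure₂_nu₂_isProbabilityMeasure (n e) (hn e)
    have key := h (fun e => lawMeasure₂ (nu₂ (n e))) (fun e => map_swap_lawMeasure₂ (nu₂_isSymmetric _))
    rw [integral_pi_eq_pairExpect] at key
    have hlaw : (fun e => law₂ (lawMeasure₂ (nu₂ (R := ℝ) (n e)))) = fun e => nu₂ (n e) :=
      funext fun e => law₂_lawMeasure₂ (nu₂_nonneg (n e))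
    rw [hlaw, pairExpect_nu₂_eq_typedSum, mul_nonneg_iff_of_pos_left (prod_inv_choose₂_pos n hn)]
      at key
    exact key
  · obtain ⟨e, he⟩ : ∃ e, 2 < n e := by
      by_contra hcon
      exact hn fun e => not_lt.mp fun h => hcon ⟨e, h⟩
    rw [typedSum_eq_zero_of_two_lt Φ he]

/-- **Two-copy typed bases in measure language** — every typed sum of `Φ` is nonnegative iff `Φ`
has nonnegative integral under every product over the edges of finite swap-invariant measures on
the two states of an edge. -/
theorem typedSum_nonneg_iff_measure (Φ : Config E → Config E → ℝ) :
    (∀ n : E → ℕ, 0 ≤ typedSum Φ n) ↔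
      ∀ (ν : E → Measure (Bool × Bool)) [∀ e, IsFiniteMeasure (ν e)],
        (∀ e, (ν e).map Prod.swap = ν e) → 0 ≤ ∫ ξ, Φ (pair₁ ξ) (pair₂ ξ) ∂(Measure.pi ν) := by
  constructor
  · intro h ν _ hs
    rw [integral_pi_eq_pairExpect]
    exact (typedSum_nonneg_iff_symmetric Φ).1 h _ (fun e a b => law₂_nonneg _ _ _)
      (fun e => law₂_isSymmetric (hs e))
  · intro h
    exact typedSum_nonneg_of_probabilityMeasure Φ fun ν _ hs => h ν hs

/-- **Two-copy typed bases as a statement about couplings of two copies**: every typed sum of `Φ`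
is nonnegative iff `E[Φ(X, Y)] ≥ 0` for every pair of copies `(X, Y)` of the bond process whose
joint law is a product over the edges of exchangeable probability measures on the two states of an
edge. -/
theorem typedSum_nonneg_iff_probabilityMeasure (Φ : Config E → Config E → ℝ) :
    (∀ n : E → ℕ, 0 ≤ typedSum Φ n) ↔
      ∀ (ν : E → Measure (Bool × Bool)) [∀ e, IsProbabilityMeasure (ν e)],
        (∀ e, (ν e).map Prod.swap = ν e) → 0 ≤ ∫ ξ, Φ (pair₁ ξ) (pair₂ ξ) ∂(Measure.pi ν) := by
  constructor
  · intro h ν _ hs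
    exact (typedSum_nonneg_iff_measure Φ).1 h ν hs
  · exact typedSum_nonneg_of_probabilityMeasure Φ

end Bases

end PairExchange

end Summit.Ventures.PercRepro2
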